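import Literature.MathematicalPhysics.QuantumFieldTheory.Balaban1983to89.B12TreeDecay
import Literature.MathematicalPhysics.QuantumFieldTheory.Balaban1983to89.B13Geometry236

/-!
# T⁴ programme, spine estimate NE1′ (node O3b/H2) — THE LETTER SYSTEM OF THE COMPOSED (B3-count) CHAIN IS CONSISTENT FOR EVERY BLOCKING
# FACTOR AND EVERY OUTER RATE, WITH EVERY LETTER LIVE — AND WHAT IT COSTS: the located (B5)-KIND clauses DISPLAYED by S44 ∕ S51 ∕ S57 ∕ S62
# (`hκk`, `h229k`, `hs0`∕`hs1`∕`ht`, `hκR`, `hrate2`, `hκ`, `h229`, `hRR`, `hrate`, `hsmall`, `hϱ`, `hϱA`) admit, for every `3 ≤ L` and every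
# `0 ≤ r₁`, letters `δ κ α₆ R_k b₀ s t ε r R v Rkp A₀ A₁ ϱ` with `α₆, s, t, b₀, ε, v, A₁ > 0` (closed forms, five clauses WITH EQUALITY); and
# NECESSARILY the uncovered-cube letters are EXPONENTIALLY SMALL IN THE RATES (`64·s ≤ (R_k − κ₀)·e^{−5R_k − b₀t}`,
# `64·v ≤ (R − r₁ − 2κ₀ − 2)·e^{−5R}`), the outer rate is paid out of `R` (`r₁ + 2κ₀ + 2 ≤ R`) and the inner rate out of the transfer
# factor (`κ₀ + (κ₀ + 1 + R)·a236(L)∕L ≤ R_k`), `κ₀ = 64·log 162`; [arith] on OUR clause SHAPES — [Balaban1988RGII] pp. 18–20 KIND only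

Cell `pub-balaban`, sub-cell `t4`, BINDER-OWNERS row NE1′ (owner lineage t4-ne1p-p1, road P1); crew seat `b2b-balaban-t4-ne1p-formalise-leaf-01`
(LEAF PROVER 01, generation 15); own-initiative crew row **W104 ∕ DAG N29zzzzzu** of `t4/formal/NE1p/LEAVES.md` (INTENT `HOME/CLAIMS.log`
l.25213; BOOKED typer RULING R-T155 l.25330 — kernel lane, ONE slot at PROPOSED, cap 300; read token X251).  ADDITIVE — imports
pv22 ∕ b12's [cite]-tagged `Literature/…/B12TreeDecay` (`K₀`, `K₀_pos`) and `…/B13Geometry236` (`a236`, `a236_pos`) ONLY; THEOREMS ONLY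
(0 `def`, 0 `def … : Prop`, 0 cite); no END is fired and nothing of S44 ∕ S51 ∕ S57 ∕ S62 ∕ W59 ∕ W75 is restated — their clause TEXT is
quoted as hypotheses ∕ conclusions of real-arithmetic lemmas.

WHY THIS FILE.  S44 ∕ S51 ∕ S57 ∕ S62 display the rate-and-letter bookkeeping of print's four resummation steps as LOCATED real
inequalities «whose standing against print's δ, κ, κ₁, α₆, L, M is NOT asserted» ((B5)-KIND).  The crew's witnesses inhabit them at
ONE letter set each (W59 ∕ W69 at `r₁ = 0`, `s = t = b₀ = 0`; W75 at `r₁ = ½`; leaf-10's rate family on `[0, 1]` at `R = R_N`, «beyond 1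
one must raise R — re-choosable too, not typed», `CLAIMS.log` l.24283).  Two questions a referee asks of such a displayed system are
answered here ONCE, for the system itself rather than for a datum: (Q1) is it CONSISTENT for every blocking factor and every outer rate,
with no letter forced to vanish?  (Q2) what does it FORCE?
* §1 NECESSITY [arith] — **`uncovered_letter_small_of_hκR`** (`hκR` alone: `64·s·e^{5R_k}·e^{b₀t} ≤ R_k − κ₀`, i.e. the (2.33)∕(2.34)-KIND
  bond letter `s` is exponentially small in the inner rate), **`outer_rate_paid_of_hrate_hRR`** (`hrate ∧ hRR`: `r₁ + 2κ₀ + 2 ≤ R` and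
  `64·v·e^{5R} ≤ R − r₁ − 2κ₀ − 2` — the uncovered-cube weight of the coarse step is exponentially small in the outer rate, and the
  decay rate `r₁` of the conclusion is paid out of `R`), **`inner_rate_large_of_hrate2`** (`hκ ∧ hκR ∧ hrate2`, `0 < ℓ`:
  `κ₀ + (κ₀ + 1 + R)∕ℓ ≤ R_k` — the fine rate exceeds the coarse one by the transfer factor `ℓ = L∕a236 L`), **`amplitude_small_of_h229`**
  (`h229`: `ε ≤ e^{5R_k − 64u_k − 5R}∕(e·64·81·K₀(64,8)²·L⁴)`).
* §2 SUFFICIENCY [arith] — **`letters_exist`**: for every `3 ≤ L` and `0 ≤ r₁` the seventeen located clauses of S51's single-component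
  END hold SIMULTANEOUSLY at explicit letters with `α₆, s, t, b₀, ε, v, A₁, δκ > 0` (`κ₀ := 64·log 162`; `δκ = r = κ₀ + 1`;
  `R = r₁ + 2κ₀ + 3`, `Rkp = r₁ + 2κ₀ + 2`, `v = e^{−5R}∕64` — `hrate`, `hRR` WITH EQUALITY; `b₀ = t = 1`, `s = e^{−5R_k}∕(64e)` so `64u_k = 1`,
  `R_k = κ₀ + 1 + (r + R)·a236 L∕L` — `hrate2` WITH EQUALITY; `α₆ = (e·64·K₀)⁻¹`, `ε` and `A₁` the reciprocals making `h229k`, `h229`, `hsmall`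
  equalities; `A₀ = 0`, `ϱ = 2`); **`h229_sets_exists`**: S51's SET-valued (2.29) clause (the extra factor `e^{A}`,
  `A = ε·e^{64u_k − 5R_k}·3⁴L⁴·K₀`) is inhabited with `ε > 0` for ALL values of the other letters (`ε := 1∕(B·max 1 D)`).
WHAT IT SAYS FOR THE WALL (the owner's reading, wall v1.8 of record, T4-DAG v48 §6 NE1; nothing re-labelled here): the (B5)-KIND half of the
composed chain is CONSISTENT AS TYPED at every `(L, r₁)` with live letters — so any failure of NE1′'s small-field bookkeeping on Bałaban's
densities must come from (B3-amp) `hAmp` ∕ (B1b) `hadm` (the identifications), not from the rate arithmetic; and the arithmetic's PRICE is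
typed: bond ∕ uncovered-cube letters exponentially small in the rates, inner rate ≳ (outer rate + κ₀)·a236(L)∕L.  Whether PRINT's letters
((2.31)–(2.34) p. 18: `exp(−κ d_k(Y))`, the `|P|`-factor, «|P| ≥ ½M⁻⁴|Z₀∖Y₀|») meet these located thresholds is NOT asserted — that is
exactly the (B5)-KIND reading the wall keeps displayed.  NOTHING of (B3) discharged on Bałaban's (2.14) densities; 0 binders instantiated
on Bałaban's densities; no wall item moves; wall v1.8 (T4-DAG v48) — words, not kind — does NOT move; R-t4r2-Q2 NOT met thereby; NE1′ ⇐
the named binders — ONE label NEW ∕ NOT PRINTED ∕ NOT PROVED; spine PROVED 0∕9; count 9 unchanged.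
HONEST FRAMING.  Real arithmetic ([arith]) on the crew's DISPLAYED clause shapes; `K₀(64,8)` and `a236` are pv22 ∕ b12's PROVED constants;
`κ₀ = 64·log 162` is the tree's located numeral (N0o `torus_consts`), not a numeral of print; print's κ, κ₁, M, (LM)⁴α ≤ 1, (2.38)'s C₃
are TYPE∕CONTEXT only; ABSOLUTE RULE honoured — nothing internally minted is cited.  Rung (B)+1 on ONE finite four-torus — NOT infinite
volume, NOT a mass gap, NOT OS on ℝ⁴, NOT Clay.  HONEST DEPENDENCY: continuum YM on T⁴ ⇐ BetaPertH ∧ nine spine estimates (0/9 proved);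
BetaPertH ⇐ (D1) ∧ (D4) ∧ CAP+tail; G-an2-4 gates asym, D1 and NE2/3/4.
-/

noncomputable section

namespace Summit.QuantumFields.BalabanUV.T4Continuum.NE1p.DressedComposedChainLetters

open Literature.MathematicalPhysics.QuantumFieldTheory.Balaban1983to89.B12TreeDecay (K₀ K₀_pos)
open Literature.MathematicalPhysics.QuantumFieldTheory.Balaban1983to89.B13Geometry236 (a236 a236_pos)

/-! ## §1 NECESSITY: what the located clauses force -/

/-- **THE BOND LETTER IS EXPONENTIALLY SMALL IN THE INNER RATE** [arith]: S51's clause `hκR` alone gives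
`64·(e^{5R_k}·s·e^{b₀t}) ≤ R_k − κ₀`, `κ₀ = 64·log 162`. -/
theorem uncovered_letter_small_of_hκR {Rk s b₀ t : ℝ}
    (hκR : 64 * Real.log 162 ≤ Rk - 64 * (Real.exp (Rk * 5) * s * Real.exp (b₀ * t))) :
    64 * (Real.exp (Rk * 5) * s * Real.exp (b₀ * t)) ≤ Rk - 64 * Real.log 162 := by
  linarith

/-- … hence, read for `s`: `s ≤ (R_k − κ₀)·e^{−5R_k}·e^{−b₀t}∕64`. [arith] -/
theorem uncovered_letter_le_of_hκR {Rk s b₀ t : ℝ}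
    (hκR : 64 * Real.log 162 ≤ Rk - 64 * (Real.exp (Rk * 5) * s * Real.exp (b₀ * t))) :
    s ≤ (Rk - 64 * Real.log 162) * Real.exp (-(Rk * 5)) * Real.exp (-(b₀ * t)) / 64 := by
  have h1 := Real.exp_pos (Rk * 5)
  have h2 := Real.exp_pos (b₀ * t)
  have h := uncovered_letter_small_of_hκR hκR
  rw [Real.exp_neg, Real.exp_neg, le_div_iff₀ (by norm_num : (0 : ℝ) < 64)]
  have : s * 64 = 64 * (Real.exp (Rk * 5) * s * Real.exp (b₀ * t)) * ((Real.exp (Rk * 5))⁻¹ * (Real.exp (b₀ * t))⁻¹) := by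
    field_simp
  rw [this]
  calc 64 * (Real.exp (Rk * 5) * s * Real.exp (b₀ * t)) * ((Real.exp (Rk * 5))⁻¹ * (Real.exp (b₀ * t))⁻¹)
      ≤ (Rk - 64 * Real.log 162) * ((Real.exp (Rk * 5))⁻¹ * (Real.exp (b₀ * t))⁻¹) :=
        mul_le_mul_of_nonneg_right h (by positivity)
    _ = (Rk - 64 * Real.log 162) * (Real.exp (Rk * 5))⁻¹ * (Real.exp (b₀ * t))⁻¹ := by ring

/-- **THE OUTER RATE IS PAID OUT OF `R`, THE UNCOVERED-CUBE WEIGHT IS EXPONENTIALLY SMALL IN IT** [arith]: S51's `hrate ∧ hRR` (with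
`0 ≤ v`) give `r₁ + 2κ₀ + 2 ≤ R` and `64·(v·e^{5R}) ≤ R − r₁ − 2κ₀ − 2`.  (Junction, by name: W94's
`DressedSmallFieldNestedToriTower.rate_le_one_of_letters : r₁ ≤ 1` IS the first conjunct read at the letter of record `R := R_N = 2κ₀ + 3`;
this is its `R`-general form — at step rate `R` the admissible outer rates are exactly `[0, R − 2κ₀ − 2]`.) -/
theorem outer_rate_paid_of_hrate_hRR {r₁ Rkp R v : ℝ} (hv : 0 ≤ v)
    (hrate : r₁ + 2 * (64 * Real.log 162) + 2 ≤ Rkp) (hRR : Rkp ≤ R - 64 * (v * Real.exp (R * 5))) :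
    r₁ + 2 * (64 * Real.log 162) + 2 ≤ R ∧ 64 * (v * Real.exp (R * 5)) ≤ R - r₁ - 2 * (64 * Real.log 162) - 2 := by
  have h := Real.exp_pos (R * 5)
  constructor
  · nlinarith [mul_nonneg hv h.le]
  · linarith

/-- **THE INNER RATE EXCEEDS THE OUTER ONE BY THE TRANSFER FACTOR** [arith]: S51's `hκ ∧ hκR ∧ hrate2` with the transfer factor
`ℓ := L∕a236 L > 0` and `0 ≤ R`, `0 ≤ s` give `κ₀ + (κ₀ + 1 + R)∕ℓ ≤ R_k`. -/
theorem inner_rate_large_of_hrate2 {Rk s b₀ t r R ℓ : ℝ} (hℓ : 0 < ℓ) (hs : 0 ≤ s)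
    (hrate2 : r + R ≤ (Rk - 64 * (Real.exp (Rk * 5) * s * Real.exp (b₀ * t)) - 64 * Real.log 162) * ℓ)
    (hκ : 64 * Real.log 162 + 1 ≤ r) :
    64 * Real.log 162 + (64 * Real.log 162 + 1 + R) / ℓ ≤ Rk := by
  have hu : 0 ≤ 64 * (Real.exp (Rk * 5) * s * Real.exp (b₀ * t)) := by positivity
  have h1 : (64 * Real.log 162 + 1 + R) / ℓ ≤ Rk - 64 * (Real.exp (Rk * 5) * s * Real.exp (b₀ * t)) - 64 * Real.log 162 := by
    rw [div_le_iff₀ hℓ]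
    linarith
  linarith

/-- **THE MEMBER AMPLITUDE IS SMALL** [arith]: S51's (2.29) clause at scale k+1 read for `ε`:
`ε ≤ e^{5R_k}·e^{−64u_k}·e^{−5R} ∕ (e·64·3⁴·K₀(64,8)²·L⁴)` (`u_k := e^{5R_k}·s·e^{b₀t}`), for `0 < L`. -/
theorem amplitude_small_of_h229 {L : ℕ} (hL : 0 < L) {Rk s b₀ t ε R : ℝ}
    (h229 : Real.exp 1 * K₀ 64 8 * 64 *
      (ε * Real.exp (64 * (Real.exp (Rk * 5) * s * Real.exp (b₀ * t)) - 5 * Rk) * ((3 : ℝ) ^ 4 * (L : ℝ) ^ 4) * K₀ 64 8 *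
        Real.exp (5 * R)) ≤ 1) :
    ε ≤ 1 / (Real.exp 1 * K₀ 64 8 * 64 *
      (Real.exp (64 * (Real.exp (Rk * 5) * s * Real.exp (b₀ * t)) - 5 * Rk) * ((3 : ℝ) ^ 4 * (L : ℝ) ^ 4) * K₀ 64 8 *
        Real.exp (5 * R))) := by
  have hK := K₀_pos (64 : ℝ) 8
  have hL' : (0 : ℝ) < L := by exact_mod_cast hL
  have hD : 0 < Real.exp 1 * K₀ 64 8 * 64 *
      (Real.exp (64 * (Real.exp (Rk * 5) * s * Real.exp (b₀ * t)) - 5 * Rk) * ((3 : ℝ) ^ 4 * (L : ℝ) ^ 4) * K₀ 64 8 *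
        Real.exp (5 * R)) := by positivity
  rw [le_div_iff₀ hD]
  calc ε * (Real.exp 1 * K₀ 64 8 * 64 *
        (Real.exp (64 * (Real.exp (Rk * 5) * s * Real.exp (b₀ * t)) - 5 * Rk) * ((3 : ℝ) ^ 4 * (L : ℝ) ^ 4) * K₀ 64 8 *
          Real.exp (5 * R)))
      = Real.exp 1 * K₀ 64 8 * 64 *
        (ε * Real.exp (64 * (Real.exp (Rk * 5) * s * Real.exp (b₀ * t)) - 5 * Rk) * ((3 : ℝ) ^ 4 * (L : ℝ) ^ 4) * K₀ 64 8 *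
          Real.exp (5 * R)) := by ring
    _ ≤ 1 := h229

/-! ## §2 SUFFICIENCY: the whole located system is inhabited, every letter live, for every `3 ≤ L` and every `0 ≤ r₁` -/

/-- **THE LETTER SYSTEM OF S51's SINGLE-COMPONENT END IS CONSISTENT WITH EVERY LETTER LIVE** [arith]: for every blocking factor `3 ≤ L`
and every outer rate `0 ≤ r₁` there are letters `δ κ α₆ R_k b₀ s t ε r R v Rkp A₀ A₁ ϱ` with `α₆, s, t, b₀, ε, v, A₁, δκ > 0` meeting
ALL of S51's located clauses — `hA₀`, `hA₁`, `hrate`, `hsmall`, `hα₆`, `hκk`, `h229k`, `hs0`, `hs1`, `ht`, `hε`, `hv`, `hκR`, `hrate2`,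
`hκ`, `h229`, `hRR`, `hϱ`, `hϱA` — VERBATIM in their located syntax (closed-form witnesses in the proof; `hrate`, `hRR`, `hrate2`, `h229k`,
`h229`, `hsmall` WITH EQUALITY). -/
theorem letters_exist {L : ℕ} (hL : 3 ≤ L) {r₁ : ℝ} (hr₁ : 0 ≤ r₁) :
    ∃ δ κ α₆ Rk b₀ s t ε r R v Rkp A₀ A₁ ϱ : ℝ,
      (0 < α₆ ∧ 0 < s ∧ 0 < t ∧ 0 < b₀ ∧ 0 < ε ∧ 0 < v ∧ 0 < A₁ ∧ 0 < δ * κ) ∧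
      0 ≤ A₀ ∧ 0 ≤ A₁ ∧ 0 ≤ r₁ ∧
      r₁ + 2 * (64 * Real.log 162) + 2 ≤ Rkp ∧
      (A₀ + ϱ * A₁) * Real.exp (5 * r₁ + 1) * K₀ 64 8 * 9 * 64 ≤ 1 ∧
      0 ≤ α₆ ∧ 64 * Real.log 162 + 1 ≤ δ * κ ∧ Real.exp 1 * K₀ 64 8 * 64 * α₆ ≤ 1 ∧
      0 ≤ s ∧ s ≤ 1 ∧ 0 ≤ t ∧ 0 ≤ ε ∧ 0 ≤ v ∧
      64 * Real.log 162 ≤ Rk - 64 * (Real.exp (Rk * 5) * s * Real.exp (b₀ * t)) ∧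
      r + R ≤ (Rk - 64 * (Real.exp (Rk * 5) * s * Real.exp (b₀ * t)) - 64 * Real.log 162) * ((L : ℝ) / a236 L) ∧
      64 * Real.log 162 + 1 ≤ r ∧
      Real.exp 1 * K₀ 64 8 * 64 *
        (ε * Real.exp (64 * (Real.exp (Rk * 5) * s * Real.exp (b₀ * t)) - 5 * Rk) * ((3 : ℝ) ^ 4 * (L : ℝ) ^ 4) * K₀ 64 8 *
          Real.exp (5 * R)) ≤ 1 ∧
      Rkp ≤ R - 64 * (v * Real.exp (R * 5)) ∧
      2 ≤ ϱ ∧ A₀ ≤ ϱ * A₁ := by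
  -- located constants
  have hlog : 0 < Real.log 162 := Real.log_pos (by norm_num)
  have hK := K₀_pos (64 : ℝ) 8
  have he := Real.exp_pos (1 : ℝ)
  have hLr : (3 : ℝ) ≤ L := by exact_mod_cast hL
  have hℓ : 0 < (L : ℝ) / a236 L := div_pos (by linarith) (a236_pos (by linarith))
  -- the witnesses
  set κ₀ : ℝ := 64 * Real.log 162 with hκ₀
  set r : ℝ := κ₀ + 1 with hr
  set R : ℝ := r₁ + 2 * κ₀ + 3 with hR
  set Rkp : ℝ := r₁ + 2 * κ₀ + 2 with hRkp
  set v : ℝ := Real.exp (-(R * 5)) / 64 with hv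
  set Rk : ℝ := κ₀ + 1 + (r + R) / ((L : ℝ) / a236 L) with hRk
  set s : ℝ := Real.exp (-(Rk * 5)) * (Real.exp (-1) / 64) with hs
  set α₆ : ℝ := (Real.exp 1 * K₀ 64 8 * 64)⁻¹ with hα₆
  set A₁ : ℝ := (2 * Real.exp (5 * r₁ + 1) * K₀ 64 8 * 9 * 64)⁻¹ with hA₁
  set ε : ℝ := (Real.exp 1 * K₀ 64 8 * 64 *
    (Real.exp (64 * (Real.exp (Rk * 5) * s * Real.exp (1 * 1)) - 5 * Rk) * ((3 : ℝ) ^ 4 * (L : ℝ) ^ 4) * K₀ 64 8 *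
      Real.exp (5 * R)))⁻¹ with hε
  have hRk0 : 0 < Rk := by
    have : 0 ≤ (r + R) / ((L : ℝ) / a236 L) := div_nonneg (by positivity) hℓ.le
    positivity
  -- the uncovered-cube letter of the fine step: `64·u_k = 1`
  have hu : Real.exp (Rk * 5) * s * Real.exp (1 * 1) = 1 / 64 := by
    rw [hs, Real.exp_neg, Real.exp_neg, one_mul]
    field_simp
  have hvR : v * Real.exp (R * 5) = 1 / 64 := by
    rw [hv, Real.exp_neg]; field_simp
  refine ⟨1, κ₀ + 1, α₆, Rk, 1, s, 1, ε, r, R, v, Rkp, 0, A₁, 2, ⟨?_, ?_, one_pos, one_pos, ?_, ?_, ?_, ?_⟩, le_rfl, ?_, hr₁,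
    ?_, ?_, ?_, ?_, ?_, ?_, ?_, zero_le_one, ?_, ?_, ?_, ?_, ?_, ?_, ?_, le_rfl, ?_⟩
  · positivity
  · positivity
  · positivity
  · positivity
  · positivity
  · rw [one_mul]; positivity
  · positivity
  · -- hrate WITH EQUALITY
    rw [hRkp]
  · -- hsmall WITH EQUALITY
    rw [hA₁, zero_add]
    have : 0 < 2 * Real.exp (5 * r₁ + 1) * K₀ 64 8 * 9 * 64 := by positivity
    rw [show (2 : ℝ) * (2 * Real.exp (5 * r₁ + 1) * K₀ 64 8 * 9 * 64)⁻¹ * Real.exp (5 * r₁ + 1) * K₀ 64 8 * 9 * 64 =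
      (2 * Real.exp (5 * r₁ + 1) * K₀ 64 8 * 9 * 64) * (2 * Real.exp (5 * r₁ + 1) * K₀ 64 8 * 9 * 64)⁻¹ by ring,
      mul_inv_cancel₀ this.ne']
  · positivity
  · rw [one_mul]
  · -- h229k WITH EQUALITY
    rw [hα₆, mul_inv_cancel₀ (by positivity : Real.exp 1 * K₀ 64 8 * 64 ≠ 0)]
  · positivity
  · -- s ≤ 1
    rw [hs, Real.exp_neg, Real.exp_neg]
    have h5 : 1 ≤ Real.exp (Rk * 5) := Real.one_le_exp (by positivity)
    have h1 : 1 ≤ Real.exp 1 := Real.one_le_exp (by norm_num)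
    calc (Real.exp (Rk * 5))⁻¹ * ((Real.exp 1)⁻¹ / 64) ≤ 1 * (1 / 64) := by
          gcongr
          · exact inv_le_one_of_one_le₀ h5
          · exact inv_le_one_of_one_le₀ h1
      _ ≤ 1 := by norm_num
  · positivity
  · positivity
  · -- hκR: `κ₀ ≤ Rk − 1`
    rw [hu]; rw [hRk]
    have : 0 ≤ (r + R) / ((L : ℝ) / a236 L) := div_nonneg (by positivity) hℓ.le
    linarith
  · -- hrate2 WITH EQUALITY
    rw [hu]
    have : (Rk - 64 * (1 / 64) - 64 * Real.log 162) = (r + R) / ((L : ℝ) / a236 L) := by rw [hRk]; ring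
    rw [this, div_mul_cancel₀ _ hℓ.ne']
  · rw [hr]
  · -- h229 WITH EQUALITY
    have hpos : 0 < Real.exp 1 * K₀ 64 8 * 64 *
        (Real.exp (64 * (Real.exp (Rk * 5) * s * Real.exp (1 * 1)) - 5 * Rk) * ((3 : ℝ) ^ 4 * (L : ℝ) ^ 4) * K₀ 64 8 *
          Real.exp (5 * R)) := by positivity
    rw [show Real.exp 1 * K₀ 64 8 * 64 *
        (ε * Real.exp (64 * (Real.exp (Rk * 5) * s * Real.exp (1 * 1)) - 5 * Rk) * ((3 : ℝ) ^ 4 * (L : ℝ) ^ 4) * K₀ 64 8 *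
          Real.exp (5 * R)) =
      ε * (Real.exp 1 * K₀ 64 8 * 64 *
        (Real.exp (64 * (Real.exp (Rk * 5) * s * Real.exp (1 * 1)) - 5 * Rk) * ((3 : ℝ) ^ 4 * (L : ℝ) ^ 4) * K₀ 64 8 *
          Real.exp (5 * R))) by ring, hε, inv_mul_cancel₀ hpos.ne']
  · -- hRR WITH EQUALITY
    rw [hvR, hRkp, hR]; linarith
  · positivity

/-- **… AND THE SET-VALUED SYSTEM TOO** [arith]: the same for S51's set-valued END, whose (2.29) clause carries the extra factor `e^{A}`,
`A := ε·e^{64u_k − 5R_k}·3⁴L⁴·K₀(64,8)` — here only that clause is re-inhabited (the other sixteen do not mention `ε` except `0 ≤ ε`):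
for every `0 < L` and all real `Rk s b₀ t R` there is `ε > 0` meeting it. -/
theorem h229_sets_exists {L : ℕ} (hL : 0 < L) (Rk s b₀ t R : ℝ) :
    ∃ ε : ℝ, 0 < ε ∧
      Real.exp 1 * K₀ 64 8 * 64 *
        (ε * Real.exp (64 * (Real.exp (Rk * 5) * s * Real.exp (b₀ * t)) - 5 * Rk) * ((3 : ℝ) ^ 4 * (L : ℝ) ^ 4) * K₀ 64 8 *
            Real.exp (5 * R) *
          Real.exp (ε * Real.exp (64 * (Real.exp (Rk * 5) * s * Real.exp (b₀ * t)) - 5 * Rk) * ((3 : ℝ) ^ 4 * (L : ℝ) ^ 4) *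
            K₀ 64 8)) ≤ 1 := by
  have hK := K₀_pos (64 : ℝ) 8
  have hL' : (0 : ℝ) < L := by exact_mod_cast hL
  -- `B := e^{64u−5Rk}·3⁴L⁴·K₀` and `D := e·K₀·64·B·e^{5R}`; take `ε := min (1∕B) (1∕(e·D))`-type: we use `ε := 1 ∕ (B · max 1 (e·K₀·64·e^{5R}·e))`
  set B : ℝ := Real.exp (64 * (Real.exp (Rk * 5) * s * Real.exp (b₀ * t)) - 5 * Rk) * ((3 : ℝ) ^ 4 * (L : ℝ) ^ 4) * K₀ 64 8
    with hB
  have hB0 : 0 < B := by positivity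
  set D : ℝ := Real.exp 1 * K₀ 64 8 * 64 * Real.exp (5 * R) * Real.exp 1 with hD
  have hD0 : 0 < D := by positivity
  have hD1 : 1 ≤ max 1 D := le_max_left _ _
  refine ⟨1 / (B * max 1 D), by positivity, ?_⟩
  have hεB : 1 / (B * max 1 D) * B = 1 / max 1 D := by field_simp
  have hA1 : 1 / (B * max 1 D) * Real.exp (64 * (Real.exp (Rk * 5) * s * Real.exp (b₀ * t)) - 5 * Rk) *
      ((3 : ℝ) ^ 4 * (L : ℝ) ^ 4) * K₀ 64 8 = 1 / max 1 D := by rw [← hεB, hB]; ring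
  rw [hA1]
  have hexp : Real.exp (1 / max 1 D) ≤ Real.exp 1 := Real.exp_le_exp.2 (by
    rw [div_le_one (by positivity)]; exact hD1)
  calc Real.exp 1 * K₀ 64 8 * 64 * (1 / max 1 D * Real.exp (5 * R) * Real.exp (1 / max 1 D))
      ≤ Real.exp 1 * K₀ 64 8 * 64 * (1 / max 1 D * Real.exp (5 * R) * Real.exp 1) := by gcongr
    _ = D * (1 / max 1 D) := by rw [hD]; ring
    _ ≤ max 1 D * (1 / max 1 D) := by gcongr; exact le_max_right _ _
    _ = 1 := by field_simp

end Summit.QuantumFields.BalabanUV.T4Continuum.NE1p.DressedComposedChainLetters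

end
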